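/-
Copyright (c) 2026 the pub-hodgecm-mathlib formalisation cell (harness21).  Prover seat hodgecm-mathlib-LH4-p01 (g4), 2026-09-02: «WILD MARS INDEX» — the unit index of the
conductor-`j` order at a ramified CM place, any residue characteristic (name F0P3a-p06 (g18) 10:12:43Z; wild base layer of the (D-RAM) column).
-/
import Literature.NumberTheory.Automorphic.RamifiedPlaceSigmaDepth   -- ★ p850961: σ-depth balls = conductor orders; brings ★ `RamifiedPlaceDifferent`, ★ `RamifiedPlaceEisensteinBasis`
import HarnessLib

/-!
# WILD MARS INDEX at a ramified CM place: `[𝒪_wˣ : (𝒪_v + ϖ_v^j 𝒪_w)ˣ] = q_v^j`, any residue characteristic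
# (Flicker 1998, Prop. 7 p. 84 and §6 REMARK p. 95 (Mars' letter); Serre, *Local Fields* IV §1, V §1; Neukirch I §12)

Topic `NumberTheory/Automorphic`; namespace `Literature.NumberTheory.Automorphic.UnitaryGroup`.  THEOREMS ONLY (no definition, no instance, no notation, no named fact,
no `sorry`; axioms ⊆ {propext, Classical.choice, Quot.sound}).  Cell `pub/hodgecm-mathlib` (D-0151), crux H413 = `stmt-HodgeConjecture-24833`; half A line LH4, the
WILD BASE LAYER of the (D-RAM) column of row #183 «LT-DYADIC» (name F0P3a-p06 (g18) 2026-09-02T10:12:43Z «WILD MARS INDEX» → LH4-p01 (g4); siblings ★ p850872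
`RamifiedPlaceDifferent`, ★ p850893 `RamifiedPlaceDifferentConductor`, ★ p850961 `RamifiedPlaceSigmaDepth`, ★ p850931 `RamifiedPlaceLevelNorms`).  HONEST READER LABEL:
banked base layer — consumers none live ((D-RAM) is a PRINT organ by ruling D74′; scope audit LH4-plan (g5) b4c7662647f1db69 «COVERED at v ∣ 2»); unconditional local
algebra, count-neutral; HC_CM is proved only modulo the 7 printed citations (2 remaining named inputs: hLiu418 = stmt-HodgeConjecture-24832, h413 =
stmt-HodgeConjecture-24833) until rung 0 closes.

SETTING (= ★ `RamifiedPlaceDifferent` ∕ ★ `RamifiedPlaceSigmaDepth`).  `L` CM, `w ∣ v` with `c • w = w` and `e(w|v) ≠ 1`; `E = L_w`, `F = L⁺_v`, `ι = toPlace v w`,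
`σ = σ_w = galAdicCompletionMap c hw`, `τ ∈ E` a uniformiser with Eisenstein data `τ + στ = ι u₀`, `τ·στ = −ι v₀` (`|u₀| < 1`, `|v₀| = exp(−1)`, ★
`exists_eisenstein_coeffs_of_ramified`), `D = |στ − τ| = exp(−d)` the different number, `q_v = |𝓀_v|` (`𝓀_v = 𝓀[L⁺_v]`, the `ValuativeRel` residue field; `= N(v)` by ★
`natCard_residueField_valuativeRel_eq`).  The σ-DEPTH BALLS OF UNITS `V_j = {u ∈ 𝒪_wˣ : |σu − u| ≤ exp(−2j)·D}` are the unit groups of the conductor-`j` orders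
`𝒪_v + ϖ_v^j 𝒪_w` (★ `valued_galAdicCompletionMap_sub_self_le_iff_mem_order`), i.e. Flicker's `R_E(j)^×`; they are handled WITHOUT a definition, as subgroups of `L_wˣ`
characterised by membership (`∃ V, ∀ u, u ∈ V ↔ …`, §2).

THE PRINT.  [Flicker1998UnitaryFL, §6 p. 95 REMARK (J. G. M. Mars)]: «`[R_E^× : R_E(j)^×]` is `1` if `j = 0` and `q^{j+1−f}(q^f − 1)∕(q − 1)` if `j > 0`» — for `e = 2`
(`f = 1`): `q^j`; [Prop. 7 p. 84] (tame, `E = F(√π)`).  The tree's TAME reading is ★ `LocalFields/RamifiedQuadraticOrderUnitIndex` (`index_comap_eqLocus_odd_eq_pow`: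
`[S^× : {σu ≡ u (𝔪^{2j+1})}] = q^j` for a DVR `S` with an anti-fixed uniformiser and `2 ∈ S^×`, via the twisted logarithm `(x − σx)(x + σx)⁻¹`).  THIS file proves the
statement at ANY residue characteristic (no skew uniformiser, `x + σx` may be a non-unit), replacing the twisted logarithm by the `τ`-COORDINATE of the Eisenstein basis:
**`[𝒪_wˣ : V_j] = q_v^j`** (`relIndex_eq_pow_of_sigmaDepth`), the level being `d + 2j` in absolute terms (`d = 1` tame ⇒ `2j + 1`).

THE MATHEMATICS.  (§1) Coordinates `x = ι p + ι q·τ` are unique; the PRODUCT FORMULA `(ι p + ι q τ)(ι p′ + ι q′ τ) = ι(pp′ + qq′v₀) + ι(pq′ + p′q + qq′u₀)·τ`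
(`τ² = ι u₀·τ + ι v₀`); a unit has `|p| = 1`, `|q| ≤ 1`.  (§3) For `u = ι a + ι b τ ∈ V_j` (`⟺ |b| ≤ exp(−j)`, ★ σ-DEPTH §2) put `φ_j(u) := (b ∕ (ϖ_v^j a)) mod 𝔭_v ∈ 𝓀_v`:
by the product formula `φ_j(uu′) − φ_j(u) − φ_j(u′) = bb′(u₀aa′ − (ab′ + a′b)v₀) ∕ (ϖ_v^j(aa′ + bb′v₀)aa′)` has valuation `≤ exp(−2j−1)∕exp(−j) < 1`
(`valued_coordRatio_mul_sub_add_lt_one`), so `φ_j : V_j → (𝓀_v, +)` is a HOMOMORPHISM; it is ONTO (`1 + ι(ϖ_v^j r)τ ↦ r̄`) with KERNEL `V_{j+1}` (`|b| < exp(−j) ⟺ |b| ≤ exp(−j−1)`)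
(`exists_monoidHom_sigmaDepth`), whence `[V_j : V_{j+1}] = q_v` (`relIndex_sigmaDepth_succ_eq`, `Subgroup.index_ker`).  (§4) `V_0 = 𝒪_wˣ` (★ σ-DEPTH `…_le_of_mem_integer'`) and
`Subgroup.relIndex_mul_relIndex` give the HEAD by induction; corollaries in absolute-norm currency (`relIndex_eq_absNorm_pow_of_sigmaDepth`), with the different number as a
binder (`relIndex_eq_pow_of_sigmaDepth_exp_neg`: level `exp(−(d + 2j))`), and as one existence package (`exists_subgroups_sigmaDepth_relIndex_eq_pow`).  (§5) NO ODD STEPS: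
the level-`exp(−(2j+1))·D` ball equals `V_{j+1}` (`valued_galAdicCompletionMap_sub_self_le_odd_iff`), so `[𝒪_wˣ : {|σu − u| ≤ exp(−n)·D}] = q_v^⌈n∕2⌉` for all `n`
(`relIndex_eq_pow_of_sigmaDepth_odd`).

* §1 `eq_of_toPlace_add_toPlace_mul_eq`, `toPlace_add_toPlace_mul_mul_eq`, `valued_eq_one_of_valued_toPlace_add_toPlace_mul_eq_one`, `valued_one_add_toPlace_mul_eq_one`.
* §2 `exists_subgroup_units_valued_eq_one`, `exists_subgroup_sigmaDepth`, `eq_of_sigmaDepth_zero`.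
* §3 `exp_neg_sq`, `lt_exp_neg_iff_le_exp_neg_succ`, `valued_coordRatio_mul_sub_add_lt_one`, **`exists_monoidHom_sigmaDepth`**, **`relIndex_sigmaDepth_succ_eq`**.
* §4 **`relIndex_eq_pow_of_sigmaDepth`** (HEAD), `relIndex_eq_absNorm_pow_of_sigmaDepth`, `relIndex_eq_pow_of_sigmaDepth_exp_neg`, `exists_subgroups_sigmaDepth_relIndex_eq_pow`.
* §5 `valued_galAdicCompletionMap_sub_self_le_odd_iff`, `relIndex_eq_pow_of_sigmaDepth_odd`.
NOT here: the norm-one version `[𝒪_w¹ : V_j¹]` (Flicker Prop. 7 (b)) and the additive index `[𝒪_w : 𝒪_v + ϖ_v^j𝒪_w] = q_v^j` — cut on request.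

## References
* [Flicker1998UnitaryFL] Y. Z. Flicker, *Elementary proof of the fundamental lemma for a unitary group*, Canad. J. Math. 50 (1998) 74–98: Prop. 7 p. 84, §6 p. 95 REMARK (Mars).
* [Serre1979] J.-P. Serre, *Local Fields*, GTM 67 (1979): Ch. I §6 Prop. 18 (Eisenstein basis), Ch. IV §1 Prop. 4 (`i_G(σ) = ord(στ − τ)`), Ch. V §1 (the filtration `U^{(n)}`).
* [NeukirchANT1999] J. Neukirch, *Algebraic Number Theory* (1999): Ch. I §12 (orders `𝒪 + 𝔣𝒪_K`, conductor, the unit index `#(𝒪_K∕𝔣)ˣ ∕ #(𝒪∕𝔣)ˣ`), Ch. II (4.3).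
* [LabesseLanglands1979] J.-P. Labesse, R. P. Langlands, *L-indistinguishability for SL(2)*, Canad. J. Math. 31 (1979): §2 p. 7 (the norm form `N(a + bτ)`).
-/

set_option autoImplicit false

noncomputable section

open NumberField IsDedekindDomain ValuativeRel
open scoped ValuativeRel WithZero

namespace Literature.NumberTheory.Automorphic.UnitaryGroup

variable (L : Type) [Field L] [NumberField L] [IsCMField L] (v : HeightOneSpectrum (𝓞 ↥(maximalRealSubfield L)))
  (w : PlacesOver L v) (hw : IsCMField.complexConj L • w.1 = w.1) (he : v.asIdeal.ramificationIdx' w.1.asIdeal ≠ 1)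

/-! ## §1 Coordinates in the Eisenstein basis: uniqueness, the product formula, units -/

include hw he in
/-- **UNIQUENESS OF COORDINATES** in the Eisenstein basis `(1, τ)`: `ι p + ι q τ = ι p' + ι q' τ → p = p' ∧ q = q'` (the valuation formula ★ `valued_toPlace_add_toPlace_mul`
applied to the difference: `max (|p − p'|², |q − q'|²·|τ|) = 0`). [cite: Serre1979, Ch. I §6 Prop. 18] -/
theorem eq_of_toPlace_add_toPlace_mul_eq {τ : w.1.adicCompletion L} (hτ : Valued.v τ = WithZero.exp (-1 : ℤ))
    {p q p' q' : v.adicCompletion ↥(maximalRealSubfield L)} (h : toPlace v w p + toPlace v w q * τ = toPlace v w p' + toPlace v w q' * τ) :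
    p = p' ∧ q = q' := by
  have h0 : toPlace v w (p - p') + toPlace v w (q - q') * τ = 0 := by
    rw [map_sub, map_sub]; linear_combination h
  have hval := valued_toPlace_add_toPlace_mul L v w hw he hτ (p - p') (q - q')
  rw [h0, map_zero] at hval
  have hp : Valued.v (p - p') ^ 2 = 0 := le_antisymm (by rw [hval]; exact le_max_left _ _) zero_le
  have hq : Valued.v (q - q') ^ 2 * WithZero.exp (-1 : ℤ) = 0 := le_antisymm (by rw [hval]; exact le_max_right _ _) zero_le
  refine ⟨sub_eq_zero.1 ((Valuation.zero_iff _).1 (pow_eq_zero_iff two_ne_zero |>.1 hp)), ?_⟩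
  rcases mul_eq_zero.1 hq with h' | h'
  · exact sub_eq_zero.1 ((Valuation.zero_iff _).1 (pow_eq_zero_iff two_ne_zero |>.1 h'))
  · exact absurd h' WithZero.coe_ne_zero

/-- **THE PRODUCT IN THE EISENSTEIN BASIS**: with `τ + στ = ι u₀`, `τ·στ = −ι v₀` (so `τ² = ι u₀·τ + ι v₀`, ★ `sq_eq_of_trace_norm`),
`(ι p + ι q τ)(ι p' + ι q' τ) = ι (p p' + q q' v₀) + ι (p q' + p' q + q q' u₀)·τ`. [cite: Serre1979, Ch. I §6 Prop. 18] [cite: LabesseLanglands1979, §2 p. 7] -/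
theorem toPlace_add_toPlace_mul_mul_eq {τ : w.1.adicCompletion L} {u₀ v₀ : v.adicCompletion ↥(maximalRealSubfield L)}
    (htr : τ + galAdicCompletionMap (L := L) (IsCMField.complexConj L) hw τ = toPlace v w u₀)
    (hnm : τ * galAdicCompletionMap (L := L) (IsCMField.complexConj L) hw τ = -toPlace v w v₀)
    (p q p' q' : v.adicCompletion ↥(maximalRealSubfield L)) :
    (toPlace v w p + toPlace v w q * τ) * (toPlace v w p' + toPlace v w q' * τ) =
      toPlace v w (p * p' + q * q' * v₀) + toPlace v w (p * q' + p' * q + q * q' * u₀) * τ := by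
  have hsq : τ ^ 2 = toPlace v w u₀ * τ + toPlace v w v₀ := sq_eq_of_trace_norm htr hnm
  simp only [map_add, map_mul]
  linear_combination (toPlace v w q * toPlace v w q') * hsq

include hw he in
/-- **COORDINATES OF A UNIT**: if `|ι p + ι q τ| = 1` then `|p| = 1` and `|q| ≤ 1` (`1 = max (|p|², |q|²·exp(−1))` and the second value has odd exponent).
[cite: Serre1979, Ch. I §6 Prop. 18] -/
theorem valued_eq_one_of_valued_toPlace_add_toPlace_mul_eq_one {τ : w.1.adicCompletion L} (hτ : Valued.v τ = WithZero.exp (-1 : ℤ))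
    {p q : v.adicCompletion ↥(maximalRealSubfield L)} (h : Valued.v (toPlace v w p + toPlace v w q * τ) = 1) :
    Valued.v p = 1 ∧ Valued.v q ≤ 1 := by
  rw [valued_toPlace_add_toPlace_mul L v w hw he hτ p q] at h
  have hq : Valued.v q ≤ 1 := by
    rw [← sq_mul_exp_neg_one_le_one_iff, ← h]; exact le_max_right _ _
  refine ⟨?_, hq⟩
  -- the odd value `|q|²·exp(−1)` is never `1`
  have hne : Valued.v q ^ 2 * WithZero.exp (-1 : ℤ) ≠ 1 := by
    intro h1
    rcases eq_or_ne q 0 with hq0 | hq0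
    · rw [hq0, map_zero, zero_pow two_ne_zero, zero_mul] at h1; exact zero_ne_one h1
    obtain ⟨n, hn⟩ : ∃ n : ℤ, Valued.v q = WithZero.exp n := ⟨_, (WithZero.exp_log ((Valuation.ne_zero_iff _).2 hq0)).symm⟩
    rw [hn, ← WithZero.exp_nsmul, ← WithZero.exp_add, ← WithZero.exp_zero, WithZero.exp_inj] at h1
    simp only [nsmul_eq_mul, Nat.cast_ofNat] at h1
    omega
  have hp2 : Valued.v p ^ 2 = 1 := by
    rcases max_choice (Valued.v p ^ 2) (Valued.v q ^ 2 * WithZero.exp (-1 : ℤ)) with hm | hm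
    · rw [← hm]; exact h
    · exact absurd (hm ▸ h) hne
  exact eq_of_sq_eq_sq (by rw [hp2, one_pow])

include hw he in
/-- `|1 + ι q τ| = 1` for `|q| ≤ 1` (so `1 + ι q τ` is a unit of `𝒪_w`). [cite: Serre1979, Ch. I §6 Prop. 18] -/
theorem valued_one_add_toPlace_mul_eq_one {τ : w.1.adicCompletion L} (hτ : Valued.v τ = WithZero.exp (-1 : ℤ))
    {q : v.adicCompletion ↥(maximalRealSubfield L)} (hq : Valued.v q ≤ 1) :
    Valued.v (1 + toPlace v w q * τ) = 1 := by
  have h := valued_toPlace_add_toPlace_mul L v w hw he hτ 1 q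
  rw [map_one, map_one, one_pow] at h
  rw [h, max_eq_left]
  exact (sq_mul_exp_neg_one_le_one_iff _).2 hq


/-! ## §2 The unit ball and the σ-depth balls of units, as subgroups of `L_wˣ` (existence form — no definition is introduced) -/

omit [IsCMField L] in
/-- The units of `𝒪_w` as a subgroup of `L_wˣ`: `∃ U ≤ L_wˣ, u ∈ U ↔ |u| = 1`. [cite: Serre1979, Ch. IV §1] -/
theorem exists_subgroup_units_valued_eq_one :
    ∃ U : Subgroup (w.1.adicCompletion L)ˣ, ∀ u, u ∈ U ↔ Valued.v (u : w.1.adicCompletion L) = 1 := by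
  refine ⟨{ carrier := {u | Valued.v (u : w.1.adicCompletion L) = 1}
            mul_mem' := fun {a b} ha hb => ?_
            one_mem' := ?_
            inv_mem' := fun {a} ha => ?_ }, fun u => Iff.rfl⟩
  · simp only [Set.mem_setOf_eq] at ha hb ⊢
    rw [Units.val_mul, map_mul, ha, hb, one_mul]
  · simp only [Set.mem_setOf_eq, Units.val_one, map_one]
  · simp only [Set.mem_setOf_eq] at ha ⊢
    rw [Units.val_inv_eq_inv_val, map_inv₀, ha, inv_one]

/-- **THE σ-DEPTH BALLS OF UNITS ARE SUBGROUPS**: for any `c ∈ ℤᵐ⁰`, `∃ V ≤ L_wˣ, u ∈ V ↔ |u| = 1 ∧ |σu − u| ≤ c` (closure under `*` and `⁻¹` is ★ σ-DEPTH §4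
`valued_galAdicCompletionMap_sub_self_mul_le_of_units` ∕ `…_inv_le_of_unit`).  With `c = exp(−2j)·|στ − τ|` this is the unit group of the conductor-`j` order `𝒪_v + ϖ_v^j 𝒪_w`
(★ `valued_galAdicCompletionMap_sub_self_le_iff_mem_order`), Flicker's `R_E(j)^×`. [cite: Serre1979, Ch. IV §1] [cite: NeukirchANT1999, Ch. I §12] [cite: Flicker1998UnitaryFL, Prop. 7 p. 84] -/
theorem exists_subgroup_sigmaDepth (c : WithZero (Multiplicative ℤ)) :
    ∃ V : Subgroup (w.1.adicCompletion L)ˣ, ∀ u, u ∈ V ↔ Valued.v (u : w.1.adicCompletion L) = 1 ∧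
      Valued.v (galAdicCompletionMap (L := L) (IsCMField.complexConj L) hw (u : w.1.adicCompletion L) - u) ≤ c := by
  refine ⟨{ carrier := {u | Valued.v (u : w.1.adicCompletion L) = 1 ∧
              Valued.v (galAdicCompletionMap (L := L) (IsCMField.complexConj L) hw (u : w.1.adicCompletion L) - u) ≤ c}
            mul_mem' := fun {a b} ha hb => ?_
            one_mem' := ?_
            inv_mem' := fun {a} ha => ?_ }, fun u => Iff.rfl⟩
  · simp only [Set.mem_setOf_eq] at ha hb ⊢
    refine ⟨by rw [Units.val_mul, map_mul, ha.1, hb.1, one_mul], ?_⟩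
    rw [Units.val_mul]
    exact valued_galAdicCompletionMap_sub_self_mul_le_of_units L v w hw ha.1 hb.1 ha.2 hb.2
  · simp only [Set.mem_setOf_eq, Units.val_one, map_one, sub_self, map_zero]
    exact ⟨trivial, zero_le⟩
  · simp only [Set.mem_setOf_eq] at ha ⊢
    refine ⟨by rw [Units.val_inv_eq_inv_val, map_inv₀, ha.1, inv_one], ?_⟩
    rw [Units.val_inv_eq_inv_val]
    exact valued_galAdicCompletionMap_sub_self_inv_le_of_unit L v w hw ha.1 ha.2

include he in
/-- **LEVEL `0` IS EVERYTHING**: the σ-depth-`d` ball of units (`c = exp(−2·0)·|στ − τ|`) is the whole unit group (`σ ≡ id (mod 𝔭_w^d)`, ★ σ-DEPTH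
`valued_galAdicCompletionMap_sub_self_le_of_mem_integer'`) — `R_E(0) = R_E`. [cite: Serre1979, Ch. IV §1 Prop. 4] [cite: Flicker1998UnitaryFL, Prop. 7 p. 84] -/
theorem eq_of_sigmaDepth_zero {τ : w.1.adicCompletion L} (hτ : Valued.v τ = WithZero.exp (-1 : ℤ)) (U V : Subgroup (w.1.adicCompletion L)ˣ)
    (hU : ∀ u, u ∈ U ↔ Valued.v (u : w.1.adicCompletion L) = 1)
    (hV : ∀ u, u ∈ V ↔ Valued.v (u : w.1.adicCompletion L) = 1 ∧
      Valued.v (galAdicCompletionMap (L := L) (IsCMField.complexConj L) hw (u : w.1.adicCompletion L) - u) ≤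
        WithZero.exp (-(2 * (0 : ℕ) : ℤ)) * Valued.v (galAdicCompletionMap (L := L) (IsCMField.complexConj L) hw τ - τ)) :
    V = U := by
  ext u
  rw [hU, hV]
  exact ⟨fun h => h.1, fun h => ⟨h, valued_galAdicCompletionMap_sub_self_le_of_mem_integer' L v w hw he hτ h.le⟩⟩

/-! ## §3 The graded step: `[V_j : V_{j+1}] = q_v` via the `τ`-coordinate homomorphism `V_j → (𝓀_v, +)` -/

/-- In `ℤᵐ⁰`: `exp(−j)² = exp(−2j)`. [cite: Serre1979, Ch. II §1] -/
theorem exp_neg_sq (j : ℕ) : WithZero.exp (-(j : ℤ)) ^ 2 = WithZero.exp (-(2 * j : ℤ)) := by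
  rw [← WithZero.exp_nsmul]; congr 1; simp only [nsmul_eq_mul, Nat.cast_ofNat]; ring

/-- In `ℤᵐ⁰`: `x < exp(−j) ↔ x ≤ exp(−(j+1))` (discreteness). [cite: Serre1979, Ch. II §1] -/
theorem lt_exp_neg_iff_le_exp_neg_succ (x : WithZero (Multiplicative ℤ)) (j : ℕ) :
    x < WithZero.exp (-(j : ℤ)) ↔ x ≤ WithZero.exp (-((j + 1 : ℕ) : ℤ)) := by
  rcases eq_or_ne x 0 with rfl | hx
  · exact ⟨fun _ => zero_le, fun _ => zero_lt_iff.2 WithZero.coe_ne_zero⟩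
  obtain ⟨m, rfl⟩ : ∃ m : ℤ, x = WithZero.exp m := ⟨_, (WithZero.exp_log hx).symm⟩
  rw [WithZero.exp_lt_exp, WithZero.exp_le_exp]
  push_cast
  omega

omit [IsCMField L] in
/-- **THE ERROR TERM OF THE `τ`-COORDINATE RATIO IS SMALL.**  For units `a, a′`, `|b|, |b′| ≤ exp(−j) = |ϖʲ|`, `|u₀| < 1`, `|v₀| = exp(−1)` (the Eisenstein coefficients):
`|(ab′ + a′b + bb′u₀) ∕ (ϖʲ(aa′ + bb′v₀)) − (b ∕ (ϖʲa) + b′ ∕ (ϖʲa′))| < 1` — the difference is `bb′·(u₀aa′ − (ab′ + a′b)v₀) ∕ (ϖʲ(aa′ + bb′v₀)aa′)`, of valuation `≤ exp(−2j−1) ∕ exp(−j)`.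
This is the additivity, modulo `𝔭_v`, of the coordinate ratio `b ∕ (ϖʲ a)` under the Eisenstein-basis product (§1). [cite: Serre1979, Ch. I §6 Prop. 18, Ch. IV §1] -/
theorem valued_coordRatio_mul_sub_add_lt_one {a a' b b' u₀ v₀ ϖj : v.adicCompletion ↥(maximalRealSubfield L)} {j : ℕ}
    (ha : Valued.v a = 1) (ha' : Valued.v a' = 1) (hϖj : Valued.v ϖj = WithZero.exp (-(j : ℤ)))
    (hb : Valued.v b ≤ WithZero.exp (-(j : ℤ))) (hb' : Valued.v b' ≤ WithZero.exp (-(j : ℤ)))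
    (hu₀ : Valued.v u₀ < 1) (hv₀ : Valued.v v₀ = WithZero.exp (-1 : ℤ)) :
    Valued.v ((a * b' + a' * b + b * b' * u₀) / (ϖj * (a * a' + b * b' * v₀)) - (b / (ϖj * a) + b' / (ϖj * a'))) < 1 := by
  have hj0 : WithZero.exp (-(j : ℤ)) ≤ 1 := by rw [← WithZero.exp_zero, WithZero.exp_le_exp]; omega
  have hb1 : Valued.v b ≤ 1 := hb.trans hj0
  have hb1' : Valued.v b' ≤ 1 := hb'.trans hj0
  have ha0 : a ≠ 0 := fun h => by rw [h, map_zero] at ha; exact zero_ne_one ha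
  have ha0' : a' ≠ 0 := fun h => by rw [h, map_zero] at ha'; exact zero_ne_one ha'
  have hϖ0 : ϖj ≠ 0 := fun h => by rw [h, map_zero] at hϖj; exact WithZero.zero_ne_coe hϖj
  have hden : Valued.v (a * a' + b * b' * v₀) = 1 := by
    have h1 : Valued.v (a * a') = 1 := by rw [map_mul, ha, ha', one_mul]
    have h2 : Valued.v (b * b' * v₀) < Valued.v (a * a') := by
      rw [h1, map_mul, map_mul, hv₀]
      calc Valued.v b * Valued.v b' * WithZero.exp (-1 : ℤ) ≤ 1 * 1 * WithZero.exp (-1 : ℤ) := by gcongr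
        _ < 1 := by rw [one_mul, one_mul, ← WithZero.exp_zero, WithZero.exp_lt_exp]; omega
    rw [Valuation.map_add_eq_of_lt_left _ h2, h1]
  have hden0 : a * a' + b * b' * v₀ ≠ 0 := fun h => by rw [h, map_zero] at hden; exact zero_ne_one hden
  have hϖa : ϖj * a ≠ 0 := mul_ne_zero hϖ0 ha0
  have hϖa' : ϖj * a' ≠ 0 := mul_ne_zero hϖ0 ha0'
  have hϖden : ϖj * (a * a' + b * b' * v₀) ≠ 0 := mul_ne_zero hϖ0 hden0
  have key : (a * b' + a' * b + b * b' * u₀) / (ϖj * (a * a' + b * b' * v₀)) - (b / (ϖj * a) + b' / (ϖj * a')) =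
      b * b' * (u₀ * (a * a') - (a * b' + a' * b) * v₀) / (ϖj * (a * a' + b * b' * v₀) * (a * a')) := by
    rw [div_add_div _ _ hϖa hϖa', div_sub_div _ _ hϖden (mul_ne_zero hϖa hϖa'), div_eq_div_iff (mul_ne_zero hϖden (mul_ne_zero hϖa hϖa'))
      (mul_ne_zero hϖden (mul_ne_zero ha0 ha0'))]
    ring
  have hden' : Valued.v (ϖj * (a * a' + b * b' * v₀) * (a * a')) = WithZero.exp (-(j : ℤ)) := by
    rw [map_mul, map_mul, hϖj, hden, map_mul, ha, ha', mul_one, mul_one, mul_one]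
  -- numerator `≤ exp(−2j)·exp(−1)`
  have hu₀' : Valued.v u₀ ≤ WithZero.exp (-((0 + 1 : ℕ) : ℤ)) :=
    (lt_exp_neg_iff_le_exp_neg_succ _ 0).1 (by rw [Nat.cast_zero, neg_zero, WithZero.exp_zero]; exact hu₀)
  have hnum : Valued.v (b * b' * (u₀ * (a * a') - (a * b' + a' * b) * v₀)) ≤ WithZero.exp (-(2 * j : ℤ)) * WithZero.exp (-1 : ℤ) := by
    rw [map_mul, map_mul, ← exp_neg_sq, sq]
    gcongr
    refine (Valuation.map_sub _ _ _).trans (max_le ?_ ?_)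
    · rw [map_mul, map_mul, ha, ha', mul_one, mul_one]
      simpa using hu₀'
    · rw [map_mul, hv₀]
      calc Valued.v (a * b' + a' * b) * WithZero.exp (-1 : ℤ) ≤ 1 * WithZero.exp (-1 : ℤ) := by
            gcongr
            refine (Valuation.map_add _ _ _).trans (max_le ?_ ?_)
            · rw [map_mul, ha, one_mul]; exact hb1'
            · rw [map_mul, ha', one_mul]; exact hb1
        _ = WithZero.exp (-1 : ℤ) := one_mul _
  rw [key, map_div₀, hden']
  calc Valued.v (b * b' * (u₀ * (a * a') - (a * b' + a' * b) * v₀)) / WithZero.exp (-(j : ℤ))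
      ≤ WithZero.exp (-(2 * j : ℤ)) * WithZero.exp (-1 : ℤ) / WithZero.exp (-(j : ℤ)) := by
        rw [div_eq_mul_inv, div_eq_mul_inv]; exact mul_le_mul_left hnum _
    _ = WithZero.exp (-(j : ℤ) - 1) := by
        rw [div_eq_iff WithZero.coe_ne_zero, ← WithZero.exp_add, ← WithZero.exp_add]; congr 1; ring
    _ < 1 := by rw [← WithZero.exp_zero, WithZero.exp_lt_exp]; omega

set_option maxHeartbeats 400000 in
include he in
/-- **THE `τ`-COORDINATE HOMOMORPHISM `φ_j : V_j → (𝓀_v, +)`, ONTO, WITH KERNEL `V_{j+1}`** (`V_j = {u ∈ 𝒪_wˣ : |σu − u| ≤ exp(−2j)·|στ − τ|}`).  Write `u = ι a + ι b·τ`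
in the Eisenstein basis (★ `exists_eq_toPlace_add_toPlace_mul`; `|a| = 1`, and `u ∈ V_j ↔ |b| ≤ exp(−j)` by ★ `valued_galAdicCompletionMap_sub_self_le_sq_mul_iff`); then
`φ_j(u) := (b ∕ (ϖ_vʲ a)) mod 𝔭_v` is multiplicative-to-additive by the product formula (§1: `τ`-coordinate of `uu′` = `ab′ + a′b + bb′u₀`, constant one `aa′ + bb′v₀`) and
`valued_coordRatio_mul_sub_add_lt_one`; it is ONTO (`1 + ι(ϖ_vʲ r)·τ ↦ r̄`) and `φ_j(u) = 0 ↔ |b| < exp(−j) ↔ |b| ≤ exp(−(j+1)) ↔ u ∈ V_{j+1}`.  Stated as an existence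
(no definition is introduced). [cite: Flicker1998UnitaryFL, Prop. 7 p. 84] [cite: Serre1979, Ch. IV §1, Ch. V §1] -/
theorem exists_monoidHom_sigmaDepth {τ : w.1.adicCompletion L} (hτ : Valued.v τ = WithZero.exp (-1 : ℤ)) (j : ℕ) (V V' : Subgroup (w.1.adicCompletion L)ˣ)
    (hV : ∀ u, u ∈ V ↔ Valued.v (u : w.1.adicCompletion L) = 1 ∧
      Valued.v (galAdicCompletionMap (L := L) (IsCMField.complexConj L) hw (u : w.1.adicCompletion L) - u) ≤
        WithZero.exp (-(2 * j : ℤ)) * Valued.v (galAdicCompletionMap (L := L) (IsCMField.complexConj L) hw τ - τ))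
    (hV' : ∀ u, u ∈ V' ↔ Valued.v (u : w.1.adicCompletion L) = 1 ∧
      Valued.v (galAdicCompletionMap (L := L) (IsCMField.complexConj L) hw (u : w.1.adicCompletion L) - u) ≤
        WithZero.exp (-(2 * ((j + 1 : ℕ) : ℤ))) * Valued.v (galAdicCompletionMap (L := L) (IsCMField.complexConj L) hw τ - τ)) :
    ∃ φ : V →* Multiplicative 𝓀[v.adicCompletion ↥(maximalRealSubfield L)], Function.Surjective φ ∧ φ.ker = V'.subgroupOf V := by
  classical
  -- Eisenstein data of `τ` and a uniformiser `ϖ` of `L⁺_v`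
  obtain ⟨u₀, v₀, htr, hnm, hu₀, hv₀⟩ := exists_eisenstein_coeffs_of_ramified L v w hw he hτ
  obtain ⟨π, hπ⟩ := v.valuation_exists_uniformizer ↥(maximalRealSubfield L)
  have hϖ : Valued.v (π : v.adicCompletion ↥(maximalRealSubfield L)) = WithZero.exp (-1 : ℤ) := by
    rw [HeightOneSpectrum.valuedAdicCompletion_eq_valuation', hπ]
  set ϖ : v.adicCompletion ↥(maximalRealSubfield L) := (π : v.adicCompletion ↥(maximalRealSubfield L)) with hϖdef
  have hϖj : Valued.v (ϖ ^ j) = WithZero.exp (-(j : ℤ)) := by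
    rw [map_pow, hϖ, ← WithZero.exp_nsmul]; congr 1; simp only [nsmul_eq_mul, mul_neg, mul_one]
  have hϖj0 : ϖ ^ j ≠ 0 := fun h => by rw [h, map_zero] at hϖj; exact WithZero.zero_ne_coe hϖj
  -- coordinates `x = ι (P x) + ι (Q x) · τ`
  choose P Q hPQ using fun x : w.1.adicCompletion L => exists_eq_toPlace_add_toPlace_mul L v w hw he hτ x
  -- membership in `V` / `V'` in coordinates
  have hmemV : ∀ u : (w.1.adicCompletion L)ˣ, u ∈ V ↔ Valued.v (u : w.1.adicCompletion L) = 1 ∧ Valued.v (Q u) ≤ WithZero.exp (-(j : ℤ)) := by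
    intro u
    rw [hV u, ← exp_neg_sq]
    conv_lhs => rw [hPQ (u : w.1.adicCompletion L)]
    rw [valued_galAdicCompletionMap_sub_self_le_sq_mul_iff L v w hw he hτ, ← hPQ]
  have hmemV' : ∀ u : (w.1.adicCompletion L)ˣ, u ∈ V' ↔ Valued.v (u : w.1.adicCompletion L) = 1 ∧ Valued.v (Q u) ≤ WithZero.exp (-((j + 1 : ℕ) : ℤ)) := by
    intro u
    rw [hV' u, ← exp_neg_sq]
    conv_lhs => rw [hPQ (u : w.1.adicCompletion L)]
    rw [valued_galAdicCompletionMap_sub_self_le_sq_mul_iff L v w hw he hτ, ← hPQ]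
  -- the first coordinate of a unit is a unit
  have hP1 : ∀ u : (w.1.adicCompletion L)ˣ, u ∈ V → Valued.v (P u) = 1 := by
    intro u hu
    have h1 := ((hmemV u).1 hu).1
    rw [hPQ (u : w.1.adicCompletion L)] at h1
    exact (valued_eq_one_of_valued_toPlace_add_toPlace_mul_eq_one L v w hw he hτ h1).1
  -- the coordinate ratio `Q u / (ϖ^j · P u)` is integral on `V`
  have hfint : ∀ u : V, Q (u.1 : w.1.adicCompletion L) / (ϖ ^ j * P (u.1 : w.1.adicCompletion L)) ∈ 𝒪[v.adicCompletion ↥(maximalRealSubfield L)] := by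
    intro u
    have hu := (hmemV u).1 u.2
    refine (v_le_one_iff_mem_integer _).1 ?_
    rw [map_div₀, map_mul, hϖj, hP1 u u.2, mul_one]
    exact div_le_one_of_le₀ hu.2 zero_le
  -- coordinates of `1` and of a product
  have hP1Q1 : P (1 : w.1.adicCompletion L) = 1 ∧ Q (1 : w.1.adicCompletion L) = 0 := by
    refine eq_of_toPlace_add_toPlace_mul_eq L v w hw he hτ ?_
    rw [← hPQ, map_one, map_zero, zero_mul, add_zero]
  have hPQmul : ∀ x y : w.1.adicCompletion L, P (x * y) = P x * P y + Q x * Q y * v₀ ∧ Q (x * y) = P x * Q y + P y * Q x + Q x * Q y * u₀ := by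
    intro x y
    refine eq_of_toPlace_add_toPlace_mul_eq L v w hw he hτ ?_
    rw [← hPQ, ← toPlace_add_toPlace_mul_mul_eq L v w hw htr hnm, ← hPQ, ← hPQ]
  -- residues: equality iff the difference has valuation `< 1`
  have hres : ∀ a b : 𝒪[v.adicCompletion ↥(maximalRealSubfield L)], IsLocalRing.residue _ a = IsLocalRing.residue _ b ↔ Valued.v ((a : v.adicCompletion ↥(maximalRealSubfield L)) - b) < 1 := by
    intro a b
    rw [← sub_eq_zero, ← map_sub, residue_eq_zero_iff_valuation_lt_one, ← v_lt_one_iff_valuation_lt_one, AddSubgroupClass.coe_sub]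
  -- THE HOMOMORPHISM (built as a closed term; only its values are used below)
  obtain ⟨φ, hφ⟩ : ∃ φ : V →* Multiplicative 𝓀[v.adicCompletion ↥(maximalRealSubfield L)], ∀ u : V,
      φ u = Multiplicative.ofAdd (IsLocalRing.residue _ ⟨Q (u.1 : w.1.adicCompletion L) / (ϖ ^ j * P (u.1 : w.1.adicCompletion L)), hfint u⟩) := ⟨
    { toFun := fun u => Multiplicative.ofAdd (IsLocalRing.residue _ ⟨Q (u.1 : w.1.adicCompletion L) / (ϖ ^ j * P (u.1 : w.1.adicCompletion L)), hfint u⟩)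
      map_one' := by
        rw [← ofAdd_zero, ← map_zero (IsLocalRing.residue 𝒪[v.adicCompletion ↥(maximalRealSubfield L)])]
        refine congrArg _ (congrArg _ (Subtype.ext ?_))
        simp only [OneMemClass.coe_one, Units.val_one, hP1Q1.2, zero_div, ZeroMemClass.coe_zero]
      map_mul' := fun x y => by
        rw [← ofAdd_add]
        refine congrArg _ ?_
        rw [← map_add, hres]
        push_cast
        rw [(hPQmul _ _).1, (hPQmul _ _).2]
        exact valued_coordRatio_mul_sub_add_lt_one L v (hP1 x x.2) (hP1 y y.2) hϖj ((hmemV x).1 x.2).2 ((hmemV y).1 y.2).2 hu₀ hv₀ },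
    fun u => rfl⟩
  refine ⟨φ, ?_, ?_⟩
  · -- ONTO: `1 + ι(ϖ^j r)·τ ↦ r̄`
    intro t
    refine (IsLocalRing.residue_surjective (Multiplicative.toAdd t)).elim fun r hr => ?_
    have hr1 : Valued.v (r : v.adicCompletion ↥(maximalRealSubfield L)) ≤ 1 := (v_le_one_iff_mem_integer _).2 r.2
    have hqr : Valued.v (ϖ ^ j * r) ≤ WithZero.exp (-(j : ℤ)) := by
      rw [map_mul, hϖj]; exact mul_le_of_le_one_right zero_le hr1
    have hval : Valued.v (1 + toPlace v w (ϖ ^ j * r) * τ) = 1 :=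
      valued_one_add_toPlace_mul_eq_one L v w hw he hτ (hqr.trans (by rw [← WithZero.exp_zero, WithZero.exp_le_exp]; omega))
    have hne : 1 + toPlace v w (ϖ ^ j * r) * τ ≠ 0 := fun h => by rw [h, map_zero] at hval; exact zero_ne_one hval
    have hcoord : P (1 + toPlace v w (ϖ ^ j * r) * τ) = 1 ∧ Q (1 + toPlace v w (ϖ ^ j * r) * τ) = ϖ ^ j * r := by
      refine eq_of_toPlace_add_toPlace_mul_eq L v w hw he hτ ?_
      rw [← hPQ, map_one]
    have hmem : Units.mk0 _ hne ∈ V :=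
      (hmemV _).2 ⟨by rw [Units.val_mk0]; exact hval, by rw [Units.val_mk0, hcoord.2]; exact hqr⟩
    refine ⟨⟨Units.mk0 _ hne, hmem⟩, ?_⟩
    rw [hφ, ← ofAdd_toAdd t, ← hr]
    refine congrArg _ (congrArg _ (Subtype.ext ?_))
    show Q (1 + toPlace v w (ϖ ^ j * r) * τ) / (ϖ ^ j * P (1 + toPlace v w (ϖ ^ j * r) * τ)) = r
    rw [hcoord.1, hcoord.2, mul_one, mul_div_cancel_left₀ _ hϖj0]
  · -- KERNEL `= V'`
    ext u
    have hvu : Valued.v (Q (u.1 : w.1.adicCompletion L) / (ϖ ^ j * P (u.1 : w.1.adicCompletion L))) = Valued.v (Q (u.1 : w.1.adicCompletion L)) / WithZero.exp (-(j : ℤ)) := by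
      rw [map_div₀, map_mul, hϖj, hP1 u u.2, mul_one]
    rw [MonoidHom.mem_ker, Subgroup.mem_subgroupOf, hmemV', hφ, ← ofAdd_zero, Multiplicative.ofAdd.apply_eq_iff_eq,
      ← map_zero (IsLocalRing.residue 𝒪[v.adicCompletion ↥(maximalRealSubfield L)]), hres, ZeroMemClass.coe_zero, sub_zero, hvu,
      div_lt_one₀ (zero_lt_iff.2 WithZero.coe_ne_zero), lt_exp_neg_iff_le_exp_neg_succ]
    exact ⟨fun h => ⟨((hmemV u).1 u.2).1, h⟩, fun h => h.2⟩

include he in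
/-- **THE GRADED STEP `[V_j : V_{j+1}] = q_v = |𝓀_v|`**, where `V_j = {u ∈ 𝒪_wˣ : |σu − u| ≤ exp(−2j)·|στ − τ|} = (𝒪_v + ϖ_v^j 𝒪_w)ˣ` is the unit group of the conductor-`j` order
(★ `valued_galAdicCompletionMap_sub_self_le_iff_mem_order`): the `τ`-coordinate homomorphism of `exists_monoidHom_sigmaDepth` is onto `𝓀_v` with kernel `V_{j+1}`
(`Subgroup.index_ker`).  Tame `d = 1`: ★ `RamifiedQuadraticOrder.relIndex_comap_eqLocus_odd` (there via the twisted logarithm and `2 ∈ 𝒪ˣ`; here via the `τ`-coordinate, any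
residue characteristic). [cite: Flicker1998UnitaryFL, Prop. 7 p. 84 and REMARK (Mars)] [cite: Serre1979, Ch. IV §1, Ch. V §1] [cite: NeukirchANT1999, Ch. I §12] -/
theorem relIndex_sigmaDepth_succ_eq {τ : w.1.adicCompletion L} (hτ : Valued.v τ = WithZero.exp (-1 : ℤ)) (j : ℕ) (V V' : Subgroup (w.1.adicCompletion L)ˣ)
    (hV : ∀ u, u ∈ V ↔ Valued.v (u : w.1.adicCompletion L) = 1 ∧
      Valued.v (galAdicCompletionMap (L := L) (IsCMField.complexConj L) hw (u : w.1.adicCompletion L) - u) ≤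
        WithZero.exp (-(2 * j : ℤ)) * Valued.v (galAdicCompletionMap (L := L) (IsCMField.complexConj L) hw τ - τ))
    (hV' : ∀ u, u ∈ V' ↔ Valued.v (u : w.1.adicCompletion L) = 1 ∧
      Valued.v (galAdicCompletionMap (L := L) (IsCMField.complexConj L) hw (u : w.1.adicCompletion L) - u) ≤
        WithZero.exp (-(2 * ((j + 1 : ℕ) : ℤ))) * Valued.v (galAdicCompletionMap (L := L) (IsCMField.complexConj L) hw τ - τ)) :
    V'.relIndex V = Nat.card 𝓀[v.adicCompletion ↥(maximalRealSubfield L)] := by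
  obtain ⟨φ, hsurj, hker⟩ := exists_monoidHom_sigmaDepth L v w hw he hτ j V V' hV hV'
  have h1 : V'.relIndex V = (V'.subgroupOf V).index := rfl
  have h2 : (V'.subgroupOf V).index = φ.ker.index := congrArg Subgroup.index hker.symm
  have h3 := Subgroup.index_ker φ
  have h4 := congrArg (fun H : Subgroup (Multiplicative 𝓀[v.adicCompletion ↥(maximalRealSubfield L)]) => Nat.card H) (MonoidHom.range_eq_top.2 hsurj)
  have h5 : Nat.card (⊤ : Subgroup (Multiplicative 𝓀[v.adicCompletion ↥(maximalRealSubfield L)])) = Nat.card (Multiplicative 𝓀[v.adicCompletion ↥(maximalRealSubfield L)]) := Subgroup.card_top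
  have h6 : Nat.card (Multiplicative 𝓀[v.adicCompletion ↥(maximalRealSubfield L)]) = Nat.card 𝓀[v.adicCompletion ↥(maximalRealSubfield L)] := Nat.card_congr Multiplicative.toAdd
  exact h1.trans (h2.trans (h3.trans (h4.trans (h5.trans h6))))

/-! ## §4 The wild Mars index: `[𝒪_wˣ : (𝒪_v + ϖ_v^j 𝒪_w)ˣ] = q_v^j` -/

include he in
/-- **WILD MARS INDEX (HEAD).**  At a ramified CM place `w ∣ v` of ANY residue characteristic, with `τ` a uniformiser of `L_w` and `D = |σ_w τ − τ|_w = exp(−d)` the different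
number (★ `RamifiedPlaceDifferent`): for `U = 𝒪_wˣ` (`|u| = 1`) and `V = V_j = {u ∈ 𝒪_wˣ : |σ_w u − u| ≤ exp(−2j)·D}` — the unit group of the conductor-`j` order `𝒪_v + ϖ_v^j 𝒪_w`
by ★ `valued_galAdicCompletionMap_sub_self_le_iff_mem_order` — **`[U : V_j] = q_v^j`**, `q_v = |𝓀_v|`.  This is Mars' index `[R_E^× : R_E(j)^×] = q^j` (`e = 2`) of
[Flicker1998UnitaryFL, Prop. 7 p. 84, §6 REMARK p. 95], the wild twin of ★ `RamifiedQuadraticOrder.index_comap_eqLocus_odd_eq_pow` (tame: `d = 1`, `2 ∈ 𝒪ˣ`, level `2j + 1`);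
equivalently `[𝒪_wˣ : (𝒪_v + 𝔣𝒪_w)ˣ] = #(𝒪_w ∕ 𝔣)ˣ ∕ #(𝒪_v ∕ 𝔣)ˣ·…` of [NeukirchANT1999, Ch. I §12] for `𝔣 = 𝔭_v^j`.  Proof: induction on `j` via the graded step
`relIndex_sigmaDepth_succ_eq` and `Subgroup.relIndex_mul_relIndex`; `V_0 = U` (`eq_of_sigmaDepth_zero`).  The subgroups are characterised by membership only (no definition;
they exist by `exists_subgroup_units_valued_eq_one` ∕ `exists_subgroup_sigmaDepth`). [cite: Flicker1998UnitaryFL, Prop. 7 p. 84 and REMARK (Mars), §6 p. 95]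
[cite: Serre1979, Ch. IV §1 Prop. 4, Ch. V §1] [cite: NeukirchANT1999, Ch. I §12] -/
theorem relIndex_eq_pow_of_sigmaDepth {τ : w.1.adicCompletion L} (hτ : Valued.v τ = WithZero.exp (-1 : ℤ)) (j : ℕ) (U V : Subgroup (w.1.adicCompletion L)ˣ)
    (hU : ∀ u, u ∈ U ↔ Valued.v (u : w.1.adicCompletion L) = 1)
    (hV : ∀ u, u ∈ V ↔ Valued.v (u : w.1.adicCompletion L) = 1 ∧
      Valued.v (galAdicCompletionMap (L := L) (IsCMField.complexConj L) hw (u : w.1.adicCompletion L) - u) ≤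
        WithZero.exp (-(2 * j : ℤ)) * Valued.v (galAdicCompletionMap (L := L) (IsCMField.complexConj L) hw τ - τ)) :
    V.relIndex U = Nat.card 𝓀[v.adicCompletion ↥(maximalRealSubfield L)] ^ j := by
  induction j generalizing V with
  | zero => rw [eq_of_sigmaDepth_zero L v w hw he hτ U V hU hV, Subgroup.relIndex_self, pow_zero]
  | succ j ih =>
    -- the intermediate level `W = V_j`: `V ≤ W ≤ U`
    obtain ⟨W, hW⟩ := exists_subgroup_sigmaDepth L v w hw
      (WithZero.exp (-(2 * j : ℤ)) * Valued.v (galAdicCompletionMap (L := L) (IsCMField.complexConj L) hw τ - τ))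
    have hWU : W ≤ U := fun u hu => (hU u).2 ((hW u).1 hu).1
    have hVW : V ≤ W := by
      intro u hu
      obtain ⟨h1, h2⟩ := (hV u).1 hu
      refine (hW u).2 ⟨h1, h2.trans (mul_le_mul_left (WithZero.exp_le_exp.2 (by push_cast; omega)) _)⟩
    rw [← Subgroup.relIndex_mul_relIndex V W U hVW hWU, relIndex_sigmaDepth_succ_eq L v w hw he hτ j W V hW hV, ih W hW, pow_succ']

include he in
/-- The HEAD in ABSOLUTE-NORM currency: `[𝒪_wˣ : V_j] = N(v)^j`, `N(v) = #(𝓞_{L⁺} ∕ v)` (★ `natCard_residueField_valuativeRel_eq`: `|𝓀[L⁺_v]| = N(v)`; at a ramified place also `= |𝓀[L_w]|`).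
[cite: Flicker1998UnitaryFL, Prop. 7 p. 84] [cite: NeukirchANT1999, Ch. I §12, Ch. II (4.3)] -/
theorem relIndex_eq_absNorm_pow_of_sigmaDepth {τ : w.1.adicCompletion L} (hτ : Valued.v τ = WithZero.exp (-1 : ℤ)) (j : ℕ) (U V : Subgroup (w.1.adicCompletion L)ˣ)
    (hU : ∀ u, u ∈ U ↔ Valued.v (u : w.1.adicCompletion L) = 1)
    (hV : ∀ u, u ∈ V ↔ Valued.v (u : w.1.adicCompletion L) = 1 ∧
      Valued.v (galAdicCompletionMap (L := L) (IsCMField.complexConj L) hw (u : w.1.adicCompletion L) - u) ≤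
        WithZero.exp (-(2 * j : ℤ)) * Valued.v (galAdicCompletionMap (L := L) (IsCMField.complexConj L) hw τ - τ)) :
    V.relIndex U = Nat.card (𝓞 ↥(maximalRealSubfield L) ⧸ v.asIdeal) ^ j := by
  rw [relIndex_eq_pow_of_sigmaDepth L v w hw he hτ j U V hU hV, natCard_residueField_valuativeRel_eq]

include he in
/-- The HEAD with the DIFFERENT NUMBER as a binder: if `|σ_w τ − τ| = exp(−d)` then `V = {u ∈ 𝒪_wˣ : |σ_w u − u| ≤ exp(−(d + 2j))}` has `[𝒪_wˣ : V] = q_v^j` — the σ-depth-`(d + 2j)`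
units, Serre's `U^{(d+2j−?)}`-style congruence group `{σu ≡ u (mod 𝔭_w^{d+2j})}`; tame `d = 1` gives level `2j + 1` (★ `RamifiedQuadraticOrder.index_comap_eqLocus_odd_eq_pow`).
[cite: Flicker1998UnitaryFL, Prop. 7 p. 84] [cite: Serre1979, Ch. IV §1 Prop. 4] -/
theorem relIndex_eq_pow_of_sigmaDepth_exp_neg {τ : w.1.adicCompletion L} (hτ : Valued.v τ = WithZero.exp (-1 : ℤ)) {d : ℕ}
    (hd : Valued.v (galAdicCompletionMap (L := L) (IsCMField.complexConj L) hw τ - τ) = WithZero.exp (-(d : ℤ))) (j : ℕ) (U V : Subgroup (w.1.adicCompletion L)ˣ)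
    (hU : ∀ u, u ∈ U ↔ Valued.v (u : w.1.adicCompletion L) = 1)
    (hV : ∀ u, u ∈ V ↔ Valued.v (u : w.1.adicCompletion L) = 1 ∧
      Valued.v (galAdicCompletionMap (L := L) (IsCMField.complexConj L) hw (u : w.1.adicCompletion L) - u) ≤ WithZero.exp (-((d + 2 * j : ℕ) : ℤ))) :
    V.relIndex U = Nat.card 𝓀[v.adicCompletion ↥(maximalRealSubfield L)] ^ j := by
  refine relIndex_eq_pow_of_sigmaDepth L v w hw he hτ j U V hU fun u => ?_
  rw [hV u, hd, ← WithZero.exp_add]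
  push_cast
  rw [show -(2 * (j : ℤ)) + -(d : ℤ) = -((d : ℤ) + 2 * j) by ring]

include he in
/-- **ONE PACKAGE** (existence form, for consumers that do not want to build the subgroups): for every `j` there are subgroups `V ≤ U ≤ L_wˣ` with `U = 𝒪_wˣ`,
`V = (𝒪_v + ϖ_v^j 𝒪_w)ˣ` read σ-intrinsically, and `[U : V] = q_v^j`. [cite: Flicker1998UnitaryFL, Prop. 7 p. 84 and REMARK (Mars)] [cite: NeukirchANT1999, Ch. I §12] -/
theorem exists_subgroups_sigmaDepth_relIndex_eq_pow {τ : w.1.adicCompletion L} (hτ : Valued.v τ = WithZero.exp (-1 : ℤ)) (j : ℕ) :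
    ∃ U V : Subgroup (w.1.adicCompletion L)ˣ, (∀ u, u ∈ U ↔ Valued.v (u : w.1.adicCompletion L) = 1) ∧
      (∀ u, u ∈ V ↔ Valued.v (u : w.1.adicCompletion L) = 1 ∧
        Valued.v (galAdicCompletionMap (L := L) (IsCMField.complexConj L) hw (u : w.1.adicCompletion L) - u) ≤
          WithZero.exp (-(2 * j : ℤ)) * Valued.v (galAdicCompletionMap (L := L) (IsCMField.complexConj L) hw τ - τ)) ∧
      V ≤ U ∧ V.relIndex U = Nat.card 𝓀[v.adicCompletion ↥(maximalRealSubfield L)] ^ j := by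
  obtain ⟨U, hU⟩ := exists_subgroup_units_valued_eq_one L v w
  obtain ⟨V, hV⟩ := exists_subgroup_sigmaDepth L v w hw (WithZero.exp (-(2 * j : ℤ)) * Valued.v (galAdicCompletionMap (L := L) (IsCMField.complexConj L) hw τ - τ))
  exact ⟨U, V, hU, hV, fun u hu => (hU u).2 ((hV u).1 hu).1, relIndex_eq_pow_of_sigmaDepth L v w hw he hτ j U V hU hV⟩

/-! ## §5 Odd levels: no new steps (`V_{d+2j+1} = V_{d+2j+2}`), so `[𝒪_wˣ : {|σu − u| ≤ exp(−n)·D}] = q_v^⌈n∕2⌉` for every `n` -/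

include he in
/-- **NO ODD STEPS**: `|σx − x| ≤ exp(−(2j+1))·D ↔ |σx − x| ≤ exp(−2(j+1))·D` for every `x ∈ L_w` (`|σx − x| = |q|²·D` has even exponent relative to `D`, ★ σ-DEPTH §1
`exists_valued_galAdicCompletionMap_sub_self_eq_sq_mul` ∕ `valued_galAdicCompletionMap_sub_self_ne_mul_exp_odd`). [cite: Serre1979, Ch. IV §1] -/
theorem valued_galAdicCompletionMap_sub_self_le_odd_iff {τ : w.1.adicCompletion L} (hτ : Valued.v τ = WithZero.exp (-1 : ℤ)) (j : ℕ) (x : w.1.adicCompletion L) :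
    Valued.v (galAdicCompletionMap (L := L) (IsCMField.complexConj L) hw x - x) ≤ WithZero.exp (-((2 * j + 1 : ℕ) : ℤ)) * Valued.v (galAdicCompletionMap (L := L) (IsCMField.complexConj L) hw τ - τ) ↔
      Valued.v (galAdicCompletionMap (L := L) (IsCMField.complexConj L) hw x - x) ≤ WithZero.exp (-(2 * ((j + 1 : ℕ) : ℤ))) * Valued.v (galAdicCompletionMap (L := L) (IsCMField.complexConj L) hw τ - τ) := by
  obtain ⟨q, hq⟩ := exists_valued_galAdicCompletionMap_sub_self_eq_sq_mul L v w hw he hτ x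
  have hD := valued_galAdicCompletionMap_sub_self_ne_zero L v w hw he hτ
  rw [hq, mul_le_mul_iff_of_pos_right (zero_lt_iff.2 hD), mul_le_mul_iff_of_pos_right (zero_lt_iff.2 hD)]
  rcases eq_or_ne q 0 with hq0 | hq0
  · rw [hq0, map_zero, zero_pow two_ne_zero]; exact ⟨fun _ => zero_le, fun _ => zero_le⟩
  obtain ⟨m, hm⟩ : ∃ m : ℤ, Valued.v q = WithZero.exp m := ⟨_, (WithZero.exp_log ((Valuation.ne_zero_iff _).2 hq0)).symm⟩
  rw [hm, ← WithZero.exp_nsmul, WithZero.exp_le_exp, WithZero.exp_le_exp]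
  simp only [nsmul_eq_mul, Nat.cast_ofNat]
  push_cast
  omega

include he in
/-- **THE INDEX AT AN ODD LEVEL**: `V = {u ∈ 𝒪_wˣ : |σu − u| ≤ exp(−(2j+1))·D}` equals `V_{j+1}`, so `[𝒪_wˣ : V] = q_v^{j+1}`; together with the HEAD,
`[𝒪_wˣ : {|σu − u| ≤ exp(−n)·D}] = q_v^⌈n∕2⌉` for every `n ≥ 0` (the σ-depth filtration of `𝒪_wˣ` jumps exactly at `d + 2ℕ`). [cite: Serre1979, Ch. IV §1, Ch. V §1]
[cite: Flicker1998UnitaryFL, Prop. 7 p. 84] -/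
theorem relIndex_eq_pow_of_sigmaDepth_odd {τ : w.1.adicCompletion L} (hτ : Valued.v τ = WithZero.exp (-1 : ℤ)) (j : ℕ) (U V : Subgroup (w.1.adicCompletion L)ˣ)
    (hU : ∀ u, u ∈ U ↔ Valued.v (u : w.1.adicCompletion L) = 1)
    (hV : ∀ u, u ∈ V ↔ Valued.v (u : w.1.adicCompletion L) = 1 ∧
      Valued.v (galAdicCompletionMap (L := L) (IsCMField.complexConj L) hw (u : w.1.adicCompletion L) - u) ≤
        WithZero.exp (-((2 * j + 1 : ℕ) : ℤ)) * Valued.v (galAdicCompletionMap (L := L) (IsCMField.complexConj L) hw τ - τ)) :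
    V.relIndex U = Nat.card 𝓀[v.adicCompletion ↥(maximalRealSubfield L)] ^ (j + 1) := by
  refine relIndex_eq_pow_of_sigmaDepth L v w hw he hτ (j + 1) U V hU fun u => ?_
  rw [hV u, valued_galAdicCompletionMap_sub_self_le_odd_iff L v w hw he hτ j]

end Literature.NumberTheory.Automorphic.UnitaryGroup

end
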